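import Summits.HodgeConjecture.HodgeConjecture.Theorems.F0P3cStCharTSHCDModel          -- ★ (MI) at `r = 1∕4` (LH6-p03): model letters `secondCountableTopology_GL_fin_three`, `exists_lieCarrier(_traceZero)`, `exists_coeffCarrier`, `placeForm_qsForm_eq`, `map_transpose_placeForm_qsForm`, `isUnit_det_placeForm_qsForm`, `mem_range_subtype_iff`; brings ★ `model_pins`, ★ (MP), ★ (NB), ★ (CO), ★ T5
import Summits.HodgeConjecture.HodgeConjecture.Theorems.K2E3HCDGroupToLieRpow           -- (ε5) (this seat): `exists_nhds_setLIntegral_theta_rpow_lt_top`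
import Summits.HodgeConjecture.HodgeConjecture.Theorems.K2E3HCDLieGlobalRpow             -- (ε4) (this seat): `forall_exists_nhds_setLIntegral_eta_rpow_lt_top_of_reg_sq_ss`
import Summits.HodgeConjecture.HodgeConjecture.Theorems.K2E3HCDCuspDockingRpow           -- (ε0) (this seat): `forall_exists_nhds_setLIntegral_cusp_rpow_lt_top`
import HarnessLib
import Summits.HodgeConjecture.HodgeConjecture.Theorems.K2E3HCDRegularPointsRpow         -- ★ (ε1) p856909 (K2E5-p01 (g4)): `exists_nhds_setLIntegral_eta_rpow_lt_top` (ED. 2)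
import Summits.HodgeConjecture.HodgeConjecture.Theorems.K2E3HCDescentSemisimpleRpow      -- ★ (ε3) p856929 (K2E5-p15 (g3)): `forall_exists_nhds_setLIntegral_eta_rpow_lt_top_traceZero_of_isSplitSemisimple` (ED. 2)
import Summits.HodgeConjecture.HodgeConjecture.Theorems.K2E3HCDSlodowySliceRpow          -- ★ (ε2) (this seat): `exists_nhds_setLIntegral_eta_rpow_lt_top_of_sq_zero` (ED. 3)

/-!
# K2 · E3 · (SC-an) sub-line «HC-D-ε», file (ε6) FRAME: `|D_G|^{−r}` is locally `∫⁻`-finite on the one-place model `U(σ_w, Φ₃)(L_w)` MODULO the three strata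
# (`hreg` = (ε1), `hsq` = (ε2), `hss` = (ε3)), every `0 ≤ r` with `12 r < 8`; and the cusp leaf (HC)ᵣ at the model (`12 r < 5`)

Cell `pub/hodgecm-mathlib`, crux H413 = `stmt-HodgeConjecture-24833` (lane `--supports … --as helper`); seat K2E3-p21 (g3) (HC-D-ε sub-lead), (SC-an) line lead
K2E3-p14 (g3), dealer K2E3-plan (g2).  Exponent-parametric twin of ★ `F0P3cStCharTSHCDModel` §3 (LH6-p03) under the SUB-LINE CONVENTION of (ε5): group token
`θᵣ g := (((normAbs L_w (charpoly g).discr * ((normAbs L_w (det g)) ^ 2)⁻¹ : ℝ≥0) : ℝ≥0∞)) ^ (-r)`, Lie token `ηᵣ X := ((normAbs L_w (charpoly X).discr : ℝ≥0∞)) ^ (-r)`,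
cusp token `((normAbs L_w (−4c³ − 27d²) : ℝ≥0∞)) ^ (-r)`.  THEOREMS ONLY; sorry-free; no definition ∕ instance ∕ notation.

WHAT.  At `K := L_w` (`w | v` non-split, `hw : c • w = w`), `σ := σ_w`, `J := J_w = !![0,0,1;0,1,0;1,0,0]`, `U′ := U(σ_w, J_w)(L_w)`, `F′ := L⁺_v`, `ι := algebraMap`:
* §1 HEAD-FRAME **`exists_nhds_setLIntegral_theta_rpow_lt_top_model {r} (hr0 : 0 ≤ r) (hr8 : 12 r < 8) (hreg) (hsq) (hss) ν′ g₀ : ∃ U ∈ 𝓝 g₀, ∫⁻_U θᵣ g ∂ν′ < ∞`** — the three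
  strata as HYPOTHESES in ★ GLOBAL-FINAL's letters at exponent `r`, universally quantified over the trace-zero carrier presentation `(𝔲₀, h𝔲₀)` and its Haar measure (so the
  suppliers' heads dock by `fun 𝔲₀ h𝔲₀ _ _ μ₀ _ => head …`): (ε4) `…eta_rpow_lt_top_of_reg_sq_ss` on the Lie algebra, then (ε5) `exists_nhds_setLIntegral_theta_rpow_lt_top`
  (group ⟸ Lie); every model letter discharged BY NAME exactly as in ★ (MI) §3 (★ `model_pins`, the form, `CharZero`, carriers with `borel` ∕ `addHaar`, ★ (MP) pins, ★ (NB),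
  ★ (CO), ★ T5, second countability of `GL₃`).
* §2 **`hcusp_model_rpow {r} (hr5 : 12 r < 5)`**: the cusp leaf (HC)ᵣ at the model for EVERY presentation `(A, hA)` of the Chevalley target and EVERY Haar measure on it
  ((ε0) `forall_exists_nhds_setLIntegral_cusp_rpow_lt_top` fed with the model letters) — the `hcusp` input of (ε1) at the model.
When (ε1) (K2E5-p01 (g4)), (ε2) (K2E5-p16 (g3)), (ε3) (K2E5-p15 (g3)) land, an append-only edition adds `hreg_model_rpow`, `hsq_model_rpow`, `hss_model_rpow` and the
hypothesis-free **`hcd_model_rpow {r} (hr0) (hr5) ν′ g₀`** = the MODEL binder of (ε7) `K2E3WeylDiscrLocIntRpow`.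
HONEST LABEL: count-neutral; closes no organ; HC_CM is proved only modulo the 7 printed citations (2 remaining named inputs: hLiu418 = `stmt-HodgeConjecture-24832`,
h413 = `stmt-HodgeConjecture-24833`) until rung 0 closes; (SC-an) is NOT ★.

## References
* [HarishChandra1970] Harish-Chandra (notes by G. van Dijk), *Harmonic analysis on reductive p-adic groups*, LNM 162 (1970), Part VII §1 Thm. 15, §7.
* [Rogawski1990] J. D. Rogawski, *Automorphic Representations of Unitary Groups in Three Variables*, Ann. of Math. Stud. 123 (1990), §4.9 p. 54; §12.5 p. 182.
* [PlatonovRapinchuk1994] V. Platonov, A. Rapinchuk, *Algebraic Groups and Number Theory* (1994), §3.3, §5.1.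
-/

set_option autoImplicit false
set_option linter.dupNamespace false

noncomputable section

open Set Filter MeasureTheory MeasureTheory.Measure TopologicalSpace Topology Matrix
open NumberField IsDedekindDomain
open Literature.NumberTheory Literature.NumberTheory.Automorphic Literature.NumberTheory.Automorphic.UnitaryGroup Literature.NumberTheory.Rogawski1990
open Literature.NumberTheory.GaloisRepresentations Literature.NumberTheory.GaloisRepresentations.IsNonarchimedeanLocalField Literature.NumberTheory.LocalFields
open Summit.HodgeConjecture.HodgeConjecture.Cruxes.H413
open Summit.HodgeConjecture.HodgeConjecture.Cruxes.H413.F0P3cStCharTSHCDCayleyChartAt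
open Summit.HodgeConjecture.HodgeConjecture.Cruxes.H413.F0P3cStCharTSHCDLieGlobalFinal
open Summit.HodgeConjecture.HodgeConjecture.Cruxes.H413.F0P3cStCharTSHCDCoordinates
open Summit.HodgeConjecture.HodgeConjecture.Cruxes.H413.F0P3cStCharTSTubeModelTransport
open Summit.HodgeConjecture.HodgeConjecture.Cruxes.H413.F0P3cStCharTSModelHaarPins
open Summit.HodgeConjecture.HodgeConjecture.Cruxes.H413.F0P3cStCharTSHCDModel
open Summit.HodgeConjecture.HodgeConjecture.Cruxes.H413.K2E3HCDGroupToLieRpow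
open Summit.HodgeConjecture.HodgeConjecture.Cruxes.H413.K2E3HCDLieGlobalRpow
open Summit.HodgeConjecture.HodgeConjecture.Cruxes.H413.K2E3HCDCuspDockingRpow
open scoped ENNReal NNReal MatrixGroups

namespace Summit.HodgeConjecture.HodgeConjecture.Cruxes.H413.K2E3HCDModelRpow

section CM

variable (L : Type) [Field L] [NumberField L] [IsCMField L] (v : HeightOneSpectrum (𝓞 ↥(maximalRealSubfield L)))
  (w : PlacesOver L v) (hw : IsCMField.complexConj L • w.1 = w.1)

/-! ## §1 HEAD-FRAME: `θᵣ` locally `∫⁻`-finite on `U(σ_w, Φ₃)(L_w)` modulo the three strata `hreg`, `hsq`, `hss` at exponent `r` -/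

set_option maxHeartbeats 1600000 in
-- long binder lists instantiated at the model (class of (ε5) §4 + (ε4) §4)
/-- **(ε6) FRAME — `|D_G|^{−r}` IS LOCALLY `∫⁻`-FINITE ON `U(σ_w, Φ₃)(L_w)` MODULO THE THREE STRATA**, every `0 ≤ r` with `12 r < 8`.  Hypotheses, in ★ GLOBAL-FINAL's
letters at `K = L_w` with the Lie token `ηᵣ`, universally quantified over the trace-zero carrier presentation and its Haar measure: `hreg` (REGULAR points — (ε1)
`K2E3HCDRegularPointsRpow`), `hsq` (non-zero SQUARE-ZERO points — (ε2)), `hss` (SPLIT SEMISIMPLE NON-SCALAR points — (ε3)).  Conclusion: for every Haar `ν′` on `U′` and every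
`g₀ ∈ U′`, some `U ∈ 𝓝 g₀` has `∫⁻_U θᵣ g ∂ν′ < ∞`.  Proof: the model letters of ★ (MI) §3 by name, (ε4) `…eta_rpow_lt_top_of_reg_sq_ss`, (ε5) `exists_nhds_setLIntegral_theta_rpow_lt_top`
at `G := ↥U′`, `ρ := U′.subtype`. [cite: HarishChandra1970, Part VII §1 Thm. 15] [cite: Rogawski1990, §4.9 p. 54; §12.5 p. 182] [cite: PlatonovRapinchuk1994, §3.3; §5.1] -/
theorem exists_nhds_setLIntegral_theta_rpow_lt_top_model {r : ℝ} (hr0 : 0 ≤ r) (hr8 : 12 * r < 8)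
    (hreg : ∀ (𝔲₀ : AddSubgroup (Matrix (Fin 3) (Fin 3) (w.1.adicCompletion L)))
      (_ : ∀ X, X ∈ 𝔲₀ ↔ (X.map (galAdicCompletionMap (L := L) (IsCMField.complexConj L) hw))ᵀ * placeForm (Rogawski1990.qsForm L) w.1 +
        placeForm (Rogawski1990.qsForm L) w.1 * X = 0 ∧ Matrix.trace X = 0)
      [MeasurableSpace ↥𝔲₀] [BorelSpace ↥𝔲₀] (μ₀ : Measure ↥𝔲₀) [μ₀.IsAddHaarMeasure],
      ∀ X₀ : ↥𝔲₀, LinearIndependent (w.1.adicCompletion L) ![(1 : Matrix (Fin 3) (Fin 3) (w.1.adicCompletion L)),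
          (X₀ : Matrix (Fin 3) (Fin 3) (w.1.adicCompletion L)), (X₀ : Matrix (Fin 3) (Fin 3) (w.1.adicCompletion L)) ^ 2] →
        ∃ U ∈ 𝓝 X₀, ∫⁻ X in U, ((normAbs (w.1.adicCompletion L)
          (Matrix.charpoly (X : Matrix (Fin 3) (Fin 3) (w.1.adicCompletion L))).discr : ℝ≥0∞)) ^ (-r) ∂μ₀ < ∞)
    (hsq : ∀ (𝔲₀ : AddSubgroup (Matrix (Fin 3) (Fin 3) (w.1.adicCompletion L)))
      (_ : ∀ X, X ∈ 𝔲₀ ↔ (X.map (galAdicCompletionMap (L := L) (IsCMField.complexConj L) hw))ᵀ * placeForm (Rogawski1990.qsForm L) w.1 +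
        placeForm (Rogawski1990.qsForm L) w.1 * X = 0 ∧ Matrix.trace X = 0)
      [MeasurableSpace ↥𝔲₀] [BorelSpace ↥𝔲₀] (μ₀ : Measure ↥𝔲₀) [μ₀.IsAddHaarMeasure],
      ∀ X₀ : ↥𝔲₀, X₀ ≠ 0 → (X₀ : Matrix (Fin 3) (Fin 3) (w.1.adicCompletion L)) * (X₀ : Matrix (Fin 3) (Fin 3) (w.1.adicCompletion L)) = 0 →
        ∃ U ∈ 𝓝 X₀, ∫⁻ X in U, ((normAbs (w.1.adicCompletion L)
          (Matrix.charpoly (X : Matrix (Fin 3) (Fin 3) (w.1.adicCompletion L))).discr : ℝ≥0∞)) ^ (-r) ∂μ₀ < ∞)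
    (hss : ∀ (𝔲₀ : AddSubgroup (Matrix (Fin 3) (Fin 3) (w.1.adicCompletion L)))
      (_ : ∀ X, X ∈ 𝔲₀ ↔ (X.map (galAdicCompletionMap (L := L) (IsCMField.complexConj L) hw))ᵀ * placeForm (Rogawski1990.qsForm L) w.1 +
        placeForm (Rogawski1990.qsForm L) w.1 * X = 0 ∧ Matrix.trace X = 0)
      [MeasurableSpace ↥𝔲₀] [BorelSpace ↥𝔲₀] (μ₀ : Measure ↥𝔲₀) [μ₀.IsAddHaarMeasure],
      ∀ X₀ : ↥𝔲₀, (∃ a b : w.1.adicCompletion L, a ≠ b ∧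
          ((X₀ : Matrix (Fin 3) (Fin 3) (w.1.adicCompletion L)) - a • (1 : Matrix (Fin 3) (Fin 3) (w.1.adicCompletion L))) *
            ((X₀ : Matrix (Fin 3) (Fin 3) (w.1.adicCompletion L)) - b • 1) = 0 ∧
          ∀ c : w.1.adicCompletion L, (X₀ : Matrix (Fin 3) (Fin 3) (w.1.adicCompletion L)) ≠ c • 1) →
        ∃ U ∈ 𝓝 X₀, ∫⁻ X in U, ((normAbs (w.1.adicCompletion L)
          (Matrix.charpoly (X : Matrix (Fin 3) (Fin 3) (w.1.adicCompletion L))).discr : ℝ≥0∞)) ^ (-r) ∂μ₀ < ∞)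
    [MeasurableSpace ↥(unitaryGroupOfForm (galAdicCompletionMap (L := L) (IsCMField.complexConj L) hw) (placeForm (Rogawski1990.qsForm L) w.1))]
    [BorelSpace ↥(unitaryGroupOfForm (galAdicCompletionMap (L := L) (IsCMField.complexConj L) hw) (placeForm (Rogawski1990.qsForm L) w.1))]
    (ν' : Measure ↥(unitaryGroupOfForm (galAdicCompletionMap (L := L) (IsCMField.complexConj L) hw) (placeForm (Rogawski1990.qsForm L) w.1))) [ν'.IsHaarMeasure]
    (g₀ : ↥(unitaryGroupOfForm (galAdicCompletionMap (L := L) (IsCMField.complexConj L) hw) (placeForm (Rogawski1990.qsForm L) w.1))) :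
    ∃ U ∈ 𝓝 g₀, ∫⁻ g in U,
      (((normAbs (w.1.adicCompletion L)
          (((g : ↥(unitaryGroupOfForm (galAdicCompletionMap (L := L) (IsCMField.complexConj L) hw) (placeForm (Rogawski1990.qsForm L) w.1))) :
              GL (Fin 3) (w.1.adicCompletion L)) : Matrix (Fin 3) (Fin 3) (w.1.adicCompletion L)).charpoly.discr *
        ((normAbs (w.1.adicCompletion L)
          (((g : ↥(unitaryGroupOfForm (galAdicCompletionMap (L := L) (IsCMField.complexConj L) hw) (placeForm (Rogawski1990.qsForm L) w.1))) :
              GL (Fin 3) (w.1.adicCompletion L)) : Matrix (Fin 3) (Fin 3) (w.1.adicCompletion L)).det) ^ 2)⁻¹ : ℝ≥0) : ℝ≥0∞)) ^ (-r) ∂ν' < ∞ := by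
  classical
  -- (m1) the pins of the one-place model
  obtain ⟨hσσ, -, hσc, -⟩ := model_pins L v w hw
  -- the (MP) pins of the place `w` (★ F0P3a-p07)
  have hι := isClosedEmbedding_algebraMap_adicCompletion_place (IsCMField.complexConj L) (IsCMField.complexConj_ne_one L) v w hw
  have hιr : ∀ x : w.1.adicCompletion L, galAdicCompletionMap (L := L) (IsCMField.complexConj L) hw x = x ↔
      x ∈ Set.range (algebraMap (v.adicCompletion ↥(maximalRealSubfield L)) (w.1.adicCompletion L)) :=
    fun x => galAdicCompletionMap_eq_self_iff_mem_range (IsCMField.complexConj L) (IsCMField.complexConj_ne_one L) v w hw x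
  obtain ⟨lam, hlam⟩ := exists_units_galAdicCompletionMap_eq_neg (IsCMField.complexConj L) (IsCMField.complexConj_ne_one L) v w hw
  have hE := setOf_galAdicCompletionMap_mul_self_eq_one_infinite (IsCMField.complexConj L) (IsCMField.complexConj_ne_one L) v w hw
  have hJd := isUnit_det_placeForm_qsForm L v w
  have hJ' := placeForm_qsForm_eq L v w
  -- (m5) characteristic zero
  haveI : CharZero (w.1.adicCompletion L) := charZero_of_injective_algebraMap (algebraMap (L : Type) (w.1.adicCompletion L)).injective
  have h2 : (2 : w.1.adicCompletion L) ≠ 0 := two_ne_zero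
  have h3 : (3 : w.1.adicCompletion L) ≠ 0 := three_ne_zero
  letI : Invertible (2 : w.1.adicCompletion L) := invertibleOfNonzero h2
  -- topology of `K = L_w` and `M₃(K)`
  haveI : T2Space (w.1.adicCompletion L) := (IsNonarchimedeanLocalField.isLocalField (w.1.adicCompletion L)).toT2Space
  haveI : LocallyCompactSpace (Matrix (Fin 3) (Fin 3) (w.1.adicCompletion L)) :=
    inferInstanceAs (LocallyCompactSpace (Fin 3 → Fin 3 → w.1.adicCompletion L))
  -- (m6) the carriers `𝔲`, `𝔲₀`, Borel σ-algebras, local compactness, Haar measures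
  obtain ⟨𝔲, h𝔲⟩ := exists_lieCarrier (galAdicCompletionMap (L := L) (IsCMField.complexConj L) hw) (placeForm (Rogawski1990.qsForm L) w.1)
  obtain ⟨𝔲₀, h𝔲₀⟩ := exists_lieCarrier_traceZero (galAdicCompletionMap (L := L) (IsCMField.complexConj L) hw) (placeForm (Rogawski1990.qsForm L) w.1)
  letI : MeasurableSpace ↥𝔲 := borel _
  haveI : BorelSpace ↥𝔲 := ⟨rfl⟩
  letI : MeasurableSpace ↥𝔲₀ := borel _
  haveI : BorelSpace ↥𝔲₀ := ⟨rfl⟩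
  haveI : LocallyCompactSpace ↥𝔲 :=
    (isClosedEmbedding_subtype (galAdicCompletionMap (L := L) (IsCMField.complexConj L) hw) (placeForm (Rogawski1990.qsForm L) w.1) 𝔲 hσc h𝔲).locallyCompactSpace
  haveI : LocallyCompactSpace ↥𝔲₀ :=
    (isClosed_traceZero hσc (placeForm (Rogawski1990.qsForm L) w.1) 𝔲₀ h𝔲₀).isClosedEmbedding_subtypeVal.locallyCompactSpace
  -- (m7) the coordinate letters: ★ (NB) and ★ (CO)
  have hιn := fun x => normAbs_map_eq_sq_of_involution (algebraMap (v.adicCompletion ↥(maximalRealSubfield L)) (w.1.adicCompletion L)) hι.continuous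
    (galAdicCompletionMap (L := L) (IsCMField.complexConj L) hw) hσσ hιr lam hlam x
  obtain ⟨Φ₀, -, hΦ₀⟩ := exists_coords_lie_traceZero (galAdicCompletionMap (L := L) (IsCMField.complexConj L) hw) hσσ hJ'
    (algebraMap (v.adicCompletion ↥(maximalRealSubfield L)) (w.1.adicCompletion L)) hι hιr lam hlam 𝔲₀ h𝔲₀
  -- the Lie-algebra statement at exponent `r`: (ε4) `…_of_reg_sq_ss`
  have hLie := forall_exists_nhds_setLIntegral_eta_rpow_lt_top_of_reg_sq_ss hσc hJd h3 𝔲 h𝔲 𝔲₀ h𝔲₀ (addHaar : Measure ↥𝔲₀) (addHaar : Measure ↥𝔲)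
    (algebraMap (v.adicCompletion ↥(maximalRealSubfield L)) (w.1.adicCompletion L)) hιn Φ₀ hΦ₀ hr8
    (hreg 𝔲₀ h𝔲₀ addHaar) (hsq 𝔲₀ h𝔲₀ addHaar) (hss 𝔲₀ h𝔲₀ addHaar)
  -- the group: `G := ↥U′`, `ρ := U′.subtype`; ★ T5 local compactness, second countability from `GL₃(K)`; (ε5) §4
  haveI := locallyCompactSpace_unitaryGroupOfForm (galAdicCompletionMap (L := L) (IsCMField.complexConj L) hw) (placeForm (Rogawski1990.qsForm L) w.1) hσc
  haveI : SecondCountableTopology (GL (Fin 3) (w.1.adicCompletion L)) := secondCountableTopology_GL_fin_three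
  haveI : SecondCountableTopology ↥(unitaryGroupOfForm (galAdicCompletionMap (L := L) (IsCMField.complexConj L) hw) (placeForm (Rogawski1990.qsForm L) w.1)) :=
    TopologicalSpace.Subtype.secondCountableTopology _
  exact exists_nhds_setLIntegral_theta_rpow_lt_top (galAdicCompletionMap (L := L) (IsCMField.complexConj L) hw) (placeForm (Rogawski1990.qsForm L) w.1) 𝔲
    (addHaar : Measure ↥𝔲) ((unitaryGroupOfForm (galAdicCompletionMap (L := L) (IsCMField.complexConj L) hw) (placeForm (Rogawski1990.qsForm L) w.1)).subtype) ν'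
    hσc h2 hJd h𝔲 IsInducing.subtypeVal Subtype.val_injective (mem_range_subtype_iff L v w hw) hE hr0 hLie g₀

/-! ## §2 The cusp leaf (HC)ᵣ at the model: the `hcusp` input of (ε1) for every presentation of the Chevalley target -/

/-- **(HC)ᵣ at the model** (`12 r < 5`): for EVERY presentation `(A, hA)` of the Chevalley target `{(c, d) | σ_w c = c, σ_w d = −d} ≤ L_w × L_w` and EVERY additive Haar
measure `ν` on it, `(↑|−4c³ − 27d²|_w)^(−r)` is locally `∫⁻`-finite at every point of `↥A` — (ε0) `forall_exists_nhds_setLIntegral_cusp_rpow_lt_top` fed with the model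
letters (★ `model_pins`: `σ_w` involutive; `CharZero`; ★ (MP): `ι = algebraMap` closed embedding, `Fix(σ_w) = range ι`, a skew unit).  This is the `hcusp` input of
(ε1) `K2E3HCDRegularPointsRpow` at the model. [cite: HarishChandra1970, Part VII §1 Thm. 15] [cite: PlatonovRapinchuk1994, §5.1] -/
theorem hcusp_model_rpow {r : ℝ} (hr5 : 12 * r < 5) :
    ∀ (A : AddSubgroup ((w.1.adicCompletion L) × (w.1.adicCompletion L)))
      (_ : ∀ p : (w.1.adicCompletion L) × (w.1.adicCompletion L), p ∈ A ↔
        galAdicCompletionMap (L := L) (IsCMField.complexConj L) hw p.1 = p.1 ∧ galAdicCompletionMap (L := L) (IsCMField.complexConj L) hw p.2 = -p.2)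
      [MeasurableSpace ↥A] [BorelSpace ↥A] (ν : Measure ↥A) [ν.IsAddHaarMeasure],
      ∀ a₀ : ↥A, ∃ W ∈ 𝓝 a₀, ∫⁻ a in W,
        ((normAbs (w.1.adicCompletion L) (-4 * (a : (w.1.adicCompletion L) × (w.1.adicCompletion L)).1 ^ 3 -
          27 * (a : (w.1.adicCompletion L) × (w.1.adicCompletion L)).2 ^ 2) : ℝ≥0∞)) ^ (-r) ∂ν < ∞ := by
  intro A hA _ _ ν _
  obtain ⟨hσσ, -, -, -⟩ := model_pins L v w hw
  have hι := isClosedEmbedding_algebraMap_adicCompletion_place (IsCMField.complexConj L) (IsCMField.complexConj_ne_one L) v w hw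
  have hιr : ∀ x : w.1.adicCompletion L, galAdicCompletionMap (L := L) (IsCMField.complexConj L) hw x = x ↔
      x ∈ Set.range (algebraMap (v.adicCompletion ↥(maximalRealSubfield L)) (w.1.adicCompletion L)) :=
    fun x => galAdicCompletionMap_eq_self_iff_mem_range (IsCMField.complexConj L) (IsCMField.complexConj_ne_one L) v w hw x
  obtain ⟨lam, hlam⟩ := exists_units_galAdicCompletionMap_eq_neg (IsCMField.complexConj L) (IsCMField.complexConj_ne_one L) v w hw
  haveI : CharZero (w.1.adicCompletion L) := charZero_of_injective_algebraMap (algebraMap (L : Type) (w.1.adicCompletion L)).injective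
  have h2 : (2 : w.1.adicCompletion L) ≠ 0 := two_ne_zero
  have h3 : (3 : w.1.adicCompletion L) ≠ 0 := three_ne_zero
  exact forall_exists_nhds_setLIntegral_cusp_rpow_lt_top (galAdicCompletionMap (L := L) (IsCMField.complexConj L) hw) hσσ h2 h3
    (algebraMap (v.adicCompletion ↥(maximalRealSubfield L)) (w.1.adicCompletion L)) hι hιr lam hlam A hA ν hr5

/-! ## §3 ED. 2 — the stratum (i) `hreg` DISCHARGED at the model (★ (ε1) `K2E3HCDRegularPointsRpow` ∘ §2 `hcusp_model_rpow`) -/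

/-- **`hreg` at the model, exponent `r` (`12 r < 5`)**, for EVERY presentation of the trace-zero carrier and EVERY Haar measure on it: at every REGULAR `X₀ : ↥𝔲₀`
(`1, X₀, X₀²` independent), `ηᵣ` is locally `∫⁻`-finite — ★ (ε1) `exists_nhds_setLIntegral_eta_rpow_lt_top` (K2E5-p01 (g4)) fed with the model letters (★ `model_pins`, the
form, `CharZero`, ★ (MP) skew unit, the cusp carrier `A` with `borel` ∕ `addHaar`) and §2 `hcusp_model_rpow` for its `hcusp`. [cite: HarishChandra1970, Part VII §1 Thm. 15]
[cite: Rogawski1990, §4.9 p. 54] -/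
theorem hreg_model_rpow {r : ℝ} (hr5 : 12 * r < 5) :
    ∀ (𝔲₀ : AddSubgroup (Matrix (Fin 3) (Fin 3) (w.1.adicCompletion L)))
      (_ : ∀ X, X ∈ 𝔲₀ ↔ (X.map (galAdicCompletionMap (L := L) (IsCMField.complexConj L) hw))ᵀ * placeForm (Rogawski1990.qsForm L) w.1 +
        placeForm (Rogawski1990.qsForm L) w.1 * X = 0 ∧ Matrix.trace X = 0)
      [MeasurableSpace ↥𝔲₀] [BorelSpace ↥𝔲₀] (μ₀ : Measure ↥𝔲₀) [μ₀.IsAddHaarMeasure],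
      ∀ X₀ : ↥𝔲₀, LinearIndependent (w.1.adicCompletion L) ![(1 : Matrix (Fin 3) (Fin 3) (w.1.adicCompletion L)),
          (X₀ : Matrix (Fin 3) (Fin 3) (w.1.adicCompletion L)), (X₀ : Matrix (Fin 3) (Fin 3) (w.1.adicCompletion L)) ^ 2] →
        ∃ U ∈ 𝓝 X₀, ∫⁻ X in U, ((normAbs (w.1.adicCompletion L)
          (Matrix.charpoly (X : Matrix (Fin 3) (Fin 3) (w.1.adicCompletion L))).discr : ℝ≥0∞)) ^ (-r) ∂μ₀ < ∞ := by
  classical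
  intro 𝔲₀ h𝔲₀ _ _ μ₀ _ X₀ hli
  obtain ⟨hσσ, -, hσc, -⟩ := model_pins L v w hw
  obtain ⟨lam, hlam⟩ := exists_units_galAdicCompletionMap_eq_neg (IsCMField.complexConj L) (IsCMField.complexConj_ne_one L) v w hw
  have hJσ := map_transpose_placeForm_qsForm L v w hw
  have hJd := isUnit_det_placeForm_qsForm L v w
  haveI : CharZero (w.1.adicCompletion L) := charZero_of_injective_algebraMap (algebraMap (L : Type) (w.1.adicCompletion L)).injective
  have h2 : (2 : w.1.adicCompletion L) ≠ 0 := two_ne_zero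
  haveI : T2Space (w.1.adicCompletion L) := (IsNonarchimedeanLocalField.isLocalField (w.1.adicCompletion L)).toT2Space
  -- the cusp carrier `A` with Borel σ-algebra and `addHaar`; closedness of `𝔲₀` and `A`
  obtain ⟨A, hA⟩ := exists_coeffCarrier (galAdicCompletionMap (L := L) (IsCMField.complexConj L) hw)
  letI : MeasurableSpace ↥A := borel _
  haveI : BorelSpace ↥A := ⟨rfl⟩
  have h𝔲₀c := isClosed_traceZero hσc (placeForm (Rogawski1990.qsForm L) w.1) 𝔲₀ h𝔲₀
  have hAc := isClosed_coeffGroup hσc A hA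
  haveI : LocallyCompactSpace ↥A := hAc.isClosedEmbedding_subtypeVal.locallyCompactSpace
  exact K2E3HCDRegularPointsRpow.exists_nhds_setLIntegral_eta_rpow_lt_top (galAdicCompletionMap (L := L) (IsCMField.complexConj L) hw) hσσ hJσ hJd h2 lam hlam
    𝔲₀ h𝔲₀ h𝔲₀c μ₀ A hA hAc
    (addHaar : Measure ↥A) (hcusp_model_rpow L v w hw hr5 A hA (addHaar : Measure ↥A)) X₀ hli

/-! ## §4 ED. 2 — the stratum (ii) `hss` DISCHARGED at the model (★ (ε3) `K2E3HCDescentSemisimpleRpow`) -/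

/-- **`hss` at the model, exponent `r` (`12 r < 5`)**, for EVERY presentation of the trace-zero carrier and EVERY Haar measure on it: at every SPLIT SEMISIMPLE NON-SCALAR
`X₀ : ↥𝔲₀`, `ηᵣ` is locally `∫⁻`-finite — ★ (ε3) `forall_exists_nhds_setLIntegral_eta_rpow_lt_top_traceZero_of_isSplitSemisimple` (K2E5-p15 (g3)) fed with the model letters
(★ `model_pins`, the form, `CharZero`, the companion carrier `𝔲` with `addHaar`, ★ (MP) pins, ★ (NB)). [cite: HarishChandra1970, Part VII §1 Thm. 15; Part VI Lemma 22]
[cite: Rogawski1990, §3.6 pp. 28–31] -/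
theorem hss_model_rpow {r : ℝ} (hr5 : 12 * r < 5) :
    ∀ (𝔲₀ : AddSubgroup (Matrix (Fin 3) (Fin 3) (w.1.adicCompletion L)))
      (_ : ∀ X, X ∈ 𝔲₀ ↔ (X.map (galAdicCompletionMap (L := L) (IsCMField.complexConj L) hw))ᵀ * placeForm (Rogawski1990.qsForm L) w.1 +
        placeForm (Rogawski1990.qsForm L) w.1 * X = 0 ∧ Matrix.trace X = 0)
      [MeasurableSpace ↥𝔲₀] [BorelSpace ↥𝔲₀] (μ₀ : Measure ↥𝔲₀) [μ₀.IsAddHaarMeasure],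
      ∀ X₀ : ↥𝔲₀, (∃ a b : w.1.adicCompletion L, a ≠ b ∧
          ((X₀ : Matrix (Fin 3) (Fin 3) (w.1.adicCompletion L)) - a • (1 : Matrix (Fin 3) (Fin 3) (w.1.adicCompletion L))) *
            ((X₀ : Matrix (Fin 3) (Fin 3) (w.1.adicCompletion L)) - b • 1) = 0 ∧
          ∀ c : w.1.adicCompletion L, (X₀ : Matrix (Fin 3) (Fin 3) (w.1.adicCompletion L)) ≠ c • 1) →
        ∃ U ∈ 𝓝 X₀, ∫⁻ X in U, ((normAbs (w.1.adicCompletion L)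
          (Matrix.charpoly (X : Matrix (Fin 3) (Fin 3) (w.1.adicCompletion L))).discr : ℝ≥0∞)) ^ (-r) ∂μ₀ < ∞ := by
  classical
  intro 𝔲₀ h𝔲₀ _ _ μ₀ _
  obtain ⟨hσσ, -, hσc, -⟩ := model_pins L v w hw
  have hι := isClosedEmbedding_algebraMap_adicCompletion_place (IsCMField.complexConj L) (IsCMField.complexConj_ne_one L) v w hw
  have hιr : ∀ x : w.1.adicCompletion L, galAdicCompletionMap (L := L) (IsCMField.complexConj L) hw x = x ↔
      x ∈ Set.range (algebraMap (v.adicCompletion ↥(maximalRealSubfield L)) (w.1.adicCompletion L)) :=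
    fun x => galAdicCompletionMap_eq_self_iff_mem_range (IsCMField.complexConj L) (IsCMField.complexConj_ne_one L) v w hw x
  obtain ⟨lam, hlam⟩ := exists_units_galAdicCompletionMap_eq_neg (IsCMField.complexConj L) (IsCMField.complexConj_ne_one L) v w hw
  have hJσ := map_transpose_placeForm_qsForm L v w hw
  have hJd := isUnit_det_placeForm_qsForm L v w
  haveI : CharZero (w.1.adicCompletion L) := charZero_of_injective_algebraMap (algebraMap (L : Type) (w.1.adicCompletion L)).injective
  have h2 : (2 : w.1.adicCompletion L) ≠ 0 := two_ne_zero
  have h3 : (3 : w.1.adicCompletion L) ≠ 0 := three_ne_zero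
  haveI : T2Space (w.1.adicCompletion L) := (IsNonarchimedeanLocalField.isLocalField (w.1.adicCompletion L)).toT2Space
  haveI : LocallyCompactSpace (Matrix (Fin 3) (Fin 3) (w.1.adicCompletion L)) :=
    inferInstanceAs (LocallyCompactSpace (Fin 3 → Fin 3 → w.1.adicCompletion L))
  -- the companion carrier `𝔲` with Borel σ-algebra and `addHaar`
  obtain ⟨𝔲, h𝔲⟩ := exists_lieCarrier (galAdicCompletionMap (L := L) (IsCMField.complexConj L) hw) (placeForm (Rogawski1990.qsForm L) w.1)
  letI : MeasurableSpace ↥𝔲 := borel _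
  haveI : BorelSpace ↥𝔲 := ⟨rfl⟩
  haveI : LocallyCompactSpace ↥𝔲 :=
    (isClosedEmbedding_subtype (galAdicCompletionMap (L := L) (IsCMField.complexConj L) hw) (placeForm (Rogawski1990.qsForm L) w.1) 𝔲 hσc h𝔲).locallyCompactSpace
  have hιn := fun x => normAbs_map_eq_sq_of_involution (algebraMap (v.adicCompletion ↥(maximalRealSubfield L)) (w.1.adicCompletion L)) hι.continuous
    (galAdicCompletionMap (L := L) (IsCMField.complexConj L) hw) hσσ hιr lam hlam x
  exact K2E3HCDescentSemisimpleRpow.forall_exists_nhds_setLIntegral_eta_rpow_lt_top_traceZero_of_isSplitSemisimple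
    (galAdicCompletionMap (L := L) (IsCMField.complexConj L) hw) hσσ hσc
    hJσ hJd h2 h3 lam hlam 𝔲 h𝔲 𝔲₀ h𝔲₀ μ₀ (addHaar : Measure ↥𝔲) (algebraMap (v.adicCompletion ↥(maximalRealSubfield L)) (w.1.adicCompletion L)) hι hιr hιn hr5

/-! ## §5 ED. 2 — HEAD modulo the LAST stratum (iii) `hsq` (★ (ε2) `K2E3HCDSlodowySliceRpow`, K2E5-p16 (g3), in flight) -/

set_option maxHeartbeats 1600000 in
-- as §1
/-- **(ε6) ED. 2 — `θᵣ` locally `∫⁻`-finite on `U(σ_w, Φ₃)(L_w)` MODULO THE LAST STRATUM (iii) `hsq`** (non-zero square-zero points of `↥𝔲₀`, in ★ GLOBAL-FINAL's letters at exponent `r`,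
∀ `(𝔲₀, h𝔲₀, μ₀)`), for `0 ≤ r`, `12 r < 5`: §1 with `hreg := hreg_model_rpow`, `hss := hss_model_rpow` (`12 r < 5 < 8`).  The hypothesis-free `hcd_model_rpow` is ED. 3 (`hsq :=` ★ (ε2)).
[cite: HarishChandra1970, Part VII §1 Thm. 15] [cite: Rogawski1990, §4.9 p. 54; §12.5 p. 182] -/
theorem exists_nhds_setLIntegral_theta_rpow_lt_top_model₂ {r : ℝ} (hr0 : 0 ≤ r) (hr5 : 12 * r < 5)
    (hsq : ∀ (𝔲₀ : AddSubgroup (Matrix (Fin 3) (Fin 3) (w.1.adicCompletion L)))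
      (_ : ∀ X, X ∈ 𝔲₀ ↔ (X.map (galAdicCompletionMap (L := L) (IsCMField.complexConj L) hw))ᵀ * placeForm (Rogawski1990.qsForm L) w.1 +
        placeForm (Rogawski1990.qsForm L) w.1 * X = 0 ∧ Matrix.trace X = 0)
      [MeasurableSpace ↥𝔲₀] [BorelSpace ↥𝔲₀] (μ₀ : Measure ↥𝔲₀) [μ₀.IsAddHaarMeasure],
      ∀ X₀ : ↥𝔲₀, X₀ ≠ 0 → (X₀ : Matrix (Fin 3) (Fin 3) (w.1.adicCompletion L)) * (X₀ : Matrix (Fin 3) (Fin 3) (w.1.adicCompletion L)) = 0 →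
        ∃ U ∈ 𝓝 X₀, ∫⁻ X in U, ((normAbs (w.1.adicCompletion L)
          (Matrix.charpoly (X : Matrix (Fin 3) (Fin 3) (w.1.adicCompletion L))).discr : ℝ≥0∞)) ^ (-r) ∂μ₀ < ∞)
    [MeasurableSpace ↥(unitaryGroupOfForm (galAdicCompletionMap (L := L) (IsCMField.complexConj L) hw) (placeForm (Rogawski1990.qsForm L) w.1))]
    [BorelSpace ↥(unitaryGroupOfForm (galAdicCompletionMap (L := L) (IsCMField.complexConj L) hw) (placeForm (Rogawski1990.qsForm L) w.1))]
    (ν' : Measure ↥(unitaryGroupOfForm (galAdicCompletionMap (L := L) (IsCMField.complexConj L) hw) (placeForm (Rogawski1990.qsForm L) w.1))) [ν'.IsHaarMeasure]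
    (g₀ : ↥(unitaryGroupOfForm (galAdicCompletionMap (L := L) (IsCMField.complexConj L) hw) (placeForm (Rogawski1990.qsForm L) w.1))) :
    ∃ U ∈ 𝓝 g₀, ∫⁻ g in U,
      (((normAbs (w.1.adicCompletion L)
          (((g : ↥(unitaryGroupOfForm (galAdicCompletionMap (L := L) (IsCMField.complexConj L) hw) (placeForm (Rogawski1990.qsForm L) w.1))) :
              GL (Fin 3) (w.1.adicCompletion L)) : Matrix (Fin 3) (Fin 3) (w.1.adicCompletion L)).charpoly.discr *
        ((normAbs (w.1.adicCompletion L)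
          (((g : ↥(unitaryGroupOfForm (galAdicCompletionMap (L := L) (IsCMField.complexConj L) hw) (placeForm (Rogawski1990.qsForm L) w.1))) :
              GL (Fin 3) (w.1.adicCompletion L)) : Matrix (Fin 3) (Fin 3) (w.1.adicCompletion L)).det) ^ 2)⁻¹ : ℝ≥0) : ℝ≥0∞)) ^ (-r) ∂ν' < ∞ :=
  exists_nhds_setLIntegral_theta_rpow_lt_top_model L v w hw hr0 (by linarith) (hreg_model_rpow L v w hw hr5) hsq (hss_model_rpow L v w hw hr5) ν' g₀

/-! ## §6 ED. 3 — the LAST stratum (iii) `hsq` DISCHARGED at the model (★ (ε2) `K2E3HCDSlodowySliceRpow`) -/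

/-- **`hsq` at the model, exponent `r` (`12 r < 5`)**, for EVERY presentation of the trace-zero carrier and EVERY Haar measure on it: at every non-zero SQUARE-ZERO `X₀ : ↥𝔲₀`,
`ηᵣ` is locally `∫⁻`-finite — ★ (ε2) `exists_nhds_setLIntegral_eta_rpow_lt_top_of_sq_zero` at `J_w = !![0,0,1;0,1,0;1,0,0]` fed with the model letters, its `hreg` from §3
`hreg_model_rpow` and its `hss` from §4 `hss_model_rpow`. [cite: HarishChandra1970, Part VII §1 Thm. 15; Part V §4 Lemma 22] [cite: Slodowy1980, §7.4] -/
theorem hsq_model_rpow {r : ℝ} (hr5 : 12 * r < 5) :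
    ∀ (𝔲₀ : AddSubgroup (Matrix (Fin 3) (Fin 3) (w.1.adicCompletion L)))
      (_ : ∀ X, X ∈ 𝔲₀ ↔ (X.map (galAdicCompletionMap (L := L) (IsCMField.complexConj L) hw))ᵀ * placeForm (Rogawski1990.qsForm L) w.1 +
        placeForm (Rogawski1990.qsForm L) w.1 * X = 0 ∧ Matrix.trace X = 0)
      [MeasurableSpace ↥𝔲₀] [BorelSpace ↥𝔲₀] (μ₀ : Measure ↥𝔲₀) [μ₀.IsAddHaarMeasure],
      ∀ X₀ : ↥𝔲₀, X₀ ≠ 0 → (X₀ : Matrix (Fin 3) (Fin 3) (w.1.adicCompletion L)) * (X₀ : Matrix (Fin 3) (Fin 3) (w.1.adicCompletion L)) = 0 →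
        ∃ U ∈ 𝓝 X₀, ∫⁻ X in U, ((normAbs (w.1.adicCompletion L)
          (Matrix.charpoly (X : Matrix (Fin 3) (Fin 3) (w.1.adicCompletion L))).discr : ℝ≥0∞)) ^ (-r) ∂μ₀ < ∞ := by
  classical
  intro 𝔲₀ h𝔲₀ _ _ μ₀ _
  obtain ⟨hσσ, -, hσc, -⟩ := model_pins L v w hw
  have hι := isClosedEmbedding_algebraMap_adicCompletion_place (IsCMField.complexConj L) (IsCMField.complexConj_ne_one L) v w hw
  have hιr : ∀ x : w.1.adicCompletion L, galAdicCompletionMap (L := L) (IsCMField.complexConj L) hw x = x ↔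
      x ∈ Set.range (algebraMap (v.adicCompletion ↥(maximalRealSubfield L)) (w.1.adicCompletion L)) :=
    fun x => galAdicCompletionMap_eq_self_iff_mem_range (IsCMField.complexConj L) (IsCMField.complexConj_ne_one L) v w hw x
  obtain ⟨lam, hlam⟩ := exists_units_galAdicCompletionMap_eq_neg (IsCMField.complexConj L) (IsCMField.complexConj_ne_one L) v w hw
  have hJ' := placeForm_qsForm_eq L v w
  haveI : CharZero (w.1.adicCompletion L) := charZero_of_injective_algebraMap (algebraMap (L : Type) (w.1.adicCompletion L)).injective
  have h2 : (2 : w.1.adicCompletion L) ≠ 0 := two_ne_zero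
  have h3 : (3 : w.1.adicCompletion L) ≠ 0 := three_ne_zero
  letI : Invertible (2 : w.1.adicCompletion L) := invertibleOfNonzero h2
  exact K2E3HCDSlodowySliceRpow.exists_nhds_setLIntegral_eta_rpow_lt_top_of_sq_zero (galAdicCompletionMap (L := L) (IsCMField.complexConj L) hw) hσσ hσc h3
    (algebraMap (v.adicCompletion ↥(maximalRealSubfield L)) (w.1.adicCompletion L)) hι hιr lam hlam hJ' 𝔲₀ h𝔲₀ μ₀ hr5
    (hreg_model_rpow L v w hw hr5 𝔲₀ h𝔲₀ μ₀) (hss_model_rpow L v w hw hr5 𝔲₀ h𝔲₀ μ₀)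

/-! ## §7 ED. 3 — `hcd_model_rpow`, HYPOTHESIS-FREE: the MODEL binder of ★ (ε7) `K2E3WeylDiscrLocIntRpow.locallyIntegrable_weylDiscr_rpow_neg_of_forall_model` -/

/-- **(ε6) `hcd_model_rpow` — `|D_G|^{−r}` IS LOCALLY `∫⁻`-FINITE ON THE MODEL `U(σ_w, Φ₃)(L_w)`, NO HYPOTHESIS**, for every `0 ≤ r` with `12 r < 5`: for every Haar measure `ν′` on
`U′` and every `g₀ ∈ U′` there is `U ∈ 𝓝 g₀` with `∫⁻_U θᵣ g ∂ν′ < ∞` — §5 with `hsq := hsq_model_rpow`.  This is the `MODEL` binder of ★ (ε7) (K2E5-p01 (g4)) at fixed `r`: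
`locallyIntegrable_weylDiscr_rpow_neg_of_forall_model hr0 (fun L _ _ _ v w hw _ _ ν′ _ g₀ => hcd_model_rpow L v w hw hr0 hr5 ν′ g₀) L v hns νQv`.  Road «HC-D» at exponent
`r` (Harish-Chandra's `|D|^{−1∕2−ε}`, `ε = 2r − 1∕2 < 1∕3`) closes here on the model: (ε0)(ε1)(ε2)(ε3)(ε4)(ε5) by name. [cite: HarishChandra1970, Part VII §1 Thm. 15, §7]
[cite: Rogawski1990, §4.9 p. 54; §12.5 p. 182] [cite: PlatonovRapinchuk1994, §3.3; §5.1] -/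
theorem hcd_model_rpow {r : ℝ} (hr0 : 0 ≤ r) (hr5 : 12 * r < 5)
    [MeasurableSpace ↥(unitaryGroupOfForm (galAdicCompletionMap (L := L) (IsCMField.complexConj L) hw) (placeForm (Rogawski1990.qsForm L) w.1))]
    [BorelSpace ↥(unitaryGroupOfForm (galAdicCompletionMap (L := L) (IsCMField.complexConj L) hw) (placeForm (Rogawski1990.qsForm L) w.1))]
    (ν' : Measure ↥(unitaryGroupOfForm (galAdicCompletionMap (L := L) (IsCMField.complexConj L) hw) (placeForm (Rogawski1990.qsForm L) w.1))) [ν'.IsHaarMeasure]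
    (g₀ : ↥(unitaryGroupOfForm (galAdicCompletionMap (L := L) (IsCMField.complexConj L) hw) (placeForm (Rogawski1990.qsForm L) w.1))) :
    ∃ U ∈ 𝓝 g₀, ∫⁻ g in U,
      (((normAbs (w.1.adicCompletion L)
          (((g : ↥(unitaryGroupOfForm (galAdicCompletionMap (L := L) (IsCMField.complexConj L) hw) (placeForm (Rogawski1990.qsForm L) w.1))) :
              GL (Fin 3) (w.1.adicCompletion L)) : Matrix (Fin 3) (Fin 3) (w.1.adicCompletion L)).charpoly.discr *
        ((normAbs (w.1.adicCompletion L)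
          (((g : ↥(unitaryGroupOfForm (galAdicCompletionMap (L := L) (IsCMField.complexConj L) hw) (placeForm (Rogawski1990.qsForm L) w.1))) :
              GL (Fin 3) (w.1.adicCompletion L)) : Matrix (Fin 3) (Fin 3) (w.1.adicCompletion L)).det) ^ 2)⁻¹ : ℝ≥0) : ℝ≥0∞)) ^ (-r) ∂ν' < ∞ :=
  exists_nhds_setLIntegral_theta_rpow_lt_top_model₂ L v w hw hr0 hr5 (hsq_model_rpow L v w hw hr5) ν' g₀

end CM

end Summit.HodgeConjecture.HodgeConjecture.Cruxes.H413.K2E3HCDModelRpow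

end
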